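/-
Copyright: statement-level skeleton of a published paper (lit-balaban cell, Phase-2 proof seat p32 gen 46). No claims beyond
what the kernel checks below.
-/
import Literature.MathematicalPhysics.QuantumFieldTheory.Balaban1983to89.B3OnePIChainAut

/-!
# B3 — T. Bałaban, *(Higgs)₂,₃ quantum fields in a finite volume. III. Renormalization*, CMP **88** (1983) 411–445
[Balaban1983Higgs3] — p. 416 [PDF 6] (1.21)–(1.22): (1.21) WITH THE COMBINATORIC FACTORS `1/|Aut|` WRITTEN — on gen 44's
class index of the regrouping (`classEquivList : {C₀^ε} ⊔ {classes of unglueable insertions} ≃ strings of letter classes`)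
the symmetry weight of a term is the product of the symmetry weights of its letters (FILE D), so the SYMMETRY-WEIGHTED
kernels satisfy BRICK 2's transport hypotheses whenever the unweighted kernels do: the weighted class series obeys the Dyson
equation `G = C₀ + C₀XG` and equals `Σ_n C₀[XC₀]ⁿ` with the weighted self-energy `X = Σ_c (1/|Aut c|)·K_c`

statement-level skeleton of published theorems with citation tags; proofs where landed; nothing here is a claim about
the Yang–Mills mass gap

PDF held: `paper:balaban1983-higgs-2-3-quantum-fields-finite-volume` (journal page = PDF page + 410); p. 416 read as image on
the ×2 render `run/shared/lean/pub/pub-balaban/b2b-balaban-ref1/pages/1983-cmp88-higgs23-III/1983-cmp88-higgs23-III-p006-x2.png`.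

CITATION HEADER (lean-in-tree rule).  lit-balaban TYPED SKELETON (HOME `run/shared/lean/pub/lit-balaban/`), PHASE 2, seat p32
gen 46 (unit `lit-balaban-p32`; TAKING #3 line HOME/STATUS.md 2026-08-24T17:09Z, free-target protocol G.5-34(d)), row **B3.Eq1.19-1.22**
((1.21)–(1.22), p. 416) of `HOME/lit-balaban-r15/ROWS-B3.md` (fold owner r15; head `proved` under the lead g12 HEAD WORD Q25;
this file is an OPTIONAL located member of its (1.21) cell, zero head weight).  CONSUMES BY NAME: BRICK 2 = p32 gen 41's
`B3Eq121OnePIChains` (`insAmp`, `chainAmp`, `chainDeg`, `sigmaSeries`, `greenSeries`) / `B3Eq121OnePIChainsLetters`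
(`sigmaSeries_eq_greenSeries_of_equiv`, `eq121_sigmaSeries_of_equiv`, `sigmaSeries_eq_tsum_dysonTerm_of_equiv`), the typer's
`B3Sect1TwoPoint.Eq121` / `dysonTerm`, gen 44's `B3OnePIChainClasses` (`LetterClass`, `UnglueableClass`, `classEquiv`,
`classEquivList`, `classEquivList_some` / `_none`), FILE D `B3OnePIChainAut` (`autCard`, `autCard_pos`,
`autCard_eq_prod_classEquiv`).  Nothing re-declared; no declaration is added to another file's namespace.

THE PRINTED TEXT (verbatim).  p. 416: *"The function G^ε has a perturbative expansion of the following structure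
G^ε = Σ_{n=0}^∞ C₀^ε[(−δm² + Σ^ε + ∂^{ε*}Σ₁^ε + Σ₁^{ε*}∂^ε + ∂^{ε*}Σ₂^ε∂^ε)C₀^ε]ⁿ, (1.21) where C₀^ε = (−Δ₀^ε + m²)^{−1}
and Σ^ε, Σ₁^ε, Σ₂^ε are given by amputated, one-particle-irreducible graphs of the expansion of G^ε."*  p. 416, after
(1.22): *"Here we did not write, and we will not write in the future, combinatoric factors before the graphs, understanding that
they are a part of the graphical description."*

KIND «(ours)» (G.5-54).  BRICK 2 proved (1.21) as an identity of generating series for ANY kernels indexed by a bijection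
`γ ≃ List ι` satisfying two transport hypotheses (`hamp`: the kernel of a connected object is the chain kernel of its
letters; `hdeg`: orders add); gen 44 supplied the bijection of record `classEquivList`; p37's `B3ChainRegroupingValues` /
`B3OnePIChainAmplitude` the values side.  What the unwritten *"combinatoric factors"* require in addition is that WEIGHTING
each class by `1/|Aut|` preserves `hamp` — which is exactly FILE D's multiplicativity of the symmetry numbers along
(1.21).  This file records that bookkeeping step; print provenance is claimed only for the two sentences quoted.

WHAT IS PROVED (theorems + two `noncomputable def`s with bodies `letterWeight`, `termWeight`; no `Prop` fact, no `sorry`;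
standard axioms).
* `§1` (any ring `R` that is an algebra over a commutative semiring `S` of central scalars) **`insAmp_smul`**,
  **`chainAmp_smul`**: `chainAmp C₀ (w • K) l = (Π_{i∈l} w i) • chainAmp C₀ K l`.
* `§1b` THE ALGEBRAIC IDENTITY FOR ANY MULTIPLICATIVE CENTRAL WEIGHTS (`W g = Π_{i∈e g} w i` on any index bijection
  `e : γ ≃ List ι`): **`hamp_smul_of_prod`**, **`sigmaSeries_smul_eq_greenSeries`**, **`eq121_smul`**,
  **`sigmaSeries_smul_eq_tsum_dysonTerm`** — BRICK 2's three theorems for the weighted kernels; nothing in them uses the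
  specific frequency weights, which `§2`–`§3` then plug in (owner's ask (i): the symmetry weights are bookkeeping on top
  of this identity).
* `§2` **`letterWeight c = 1/|Aut c|`**, **`termWeight`** (`1` on the bare line, `1/|Aut ⟦T⟧|` on a class), `termWeight_none` /
  `_some`, `letterWeight_pos`, `termWeight_pos`, and **`prod_letterWeight_classEquivList`**:
  `Π_{c ∈ classEquivList g} letterWeight c = termWeight g` (FILE D's `autCard_eq_prod_classEquiv`);
  `termWeight_some_mkC_eq_ncard_div_factorial` (the weight of a class = its labelled frequency `#{T′ ≅ T}/V!`, FILE 2).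
* `§3` for kernels `A` (terms) and `a` (letter classes) in a `ℚ`-algebra `R` with BRICK 2's hypotheses on `classEquivList`:
  **`weighted_hamp`** (`hA : A g = chainAmp C₀ a (classEquivList g)` ⇒ the same for `termWeight • A`, `letterWeight • a`),
  **`sigmaSeries_weighted_eq_greenSeries`**, **`eq121_weighted`** (the Dyson equation `Eq121` for the weighted class series),
  **`sigmaSeries_weighted_eq_tsum_dysonTerm`** (`= Σ_n C₀[XC₀]ⁿ`).

HONEST SCOPE.  (i) The weights are the VERTEX-RELABELLING FREQUENCIES of the model's labelled structures —
`1/|Aut| = #{T′ on the V labels ≅ T}/V!` (`termWeight_some_mkC_eq_ncard_div_factorial`) for FILE 2 / FILE D's RIGID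
automorphisms (legs rigid, the two marked legs fixed); the textbook factors' leg/line permutations and vertex normalisations
are not modelled — as in FILE C/D, reading `1/|Aut|` as "the combinatoric factor" is a READING of p. 416's unwritten factors
restricted to vertex labels, not print's full Feynman factors.  The series identities themselves hold for ANY multiplicative
central weights (`§1b`).  (ii) The unweighted consistency `hA` and
the order additivity `hdeg` are HYPOTHESES here (the values side is p37's lane: `B3ChainRegroupingValues.eq121_objValue`,
`B3OnePIChainAmplitude.kernel_chain`; not imported); this file adds only the weights.  (iii) Index = gen 44's
`Option (UnglueableClass n̄)` / `LetterClass n̄`: the bare `−δm²` letter and insertions with vector separating lines are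
outside (HONEST SCOPE of `B3OnePIChainUnglue` / `B3OnePIChainClasses`).  (iv) Nothing analytic.
-/

namespace Literature.MathematicalPhysics.QuantumFieldTheory.Balaban1983to89.B3Eq121SymmetryWeights

open B3Sect1TwoPoint (dysonTerm Eq121)
open B3Eq121OnePIChains B3Eq121OnePIChainsLetters B3OnePIChainGlue B3OnePIChainUnglue B3OnePIChainClasses B3OnePIChainAut

/-! ## §1 Scaling the letters by central scalars scales a chain by the product -/

section Scaling

variable {R : Type*} [Ring R] {S : Type*} [CommSemiring S] [Algebra S R] {ι : Type*} (C0 : R) (amp : ι → R) (w : ι → S)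

/-- **Scaling every letter kernel by a central scalar scales the insertion product by the product of the scalars**
(`insAmp` of BRICK 2; the scalars act through an algebra structure, so they commute with the kernels and with `C₀`).
[cite: Balaban1983Higgs3, (1.21) p.416] -/
theorem insAmp_smul (l : List ι) : insAmp C0 (fun i => w i • amp i) l = (l.map w).prod • insAmp C0 amp l := by
  induction l with
  | nil => simp
  | cons i l ih =>
      rw [insAmp_cons, insAmp_cons, ih, List.map_cons, List.prod_cons, smul_mul_assoc, smul_mul_assoc, mul_smul_comm,
        smul_smul, mul_comm (w i)]

/-- **Scaling every letter kernel by a central scalar scales the chain kernel `C₀K₁C₀⋯K_mC₀` by the product of the scalars.**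
[cite: Balaban1983Higgs3, (1.21) p.416] -/
theorem chainAmp_smul (l : List ι) : chainAmp C0 (fun i => w i • amp i) l = (l.map w).prod • chainAmp C0 amp l := by
  unfold chainAmp
  rw [insAmp_smul, mul_smul_comm]

end Scaling

/-! ## §1b BRICK 2's transport for ANY central weights multiplicative along chains -/

section AnyWeights

variable {R : Type*} [Ring R] {S : Type*} [CommSemiring S] [Algebra S R] {σ γ ι : Type*} (C0 : R)
  (amp : ι → R) (deg : ι → σ →₀ ℕ) (ampγ : γ → R) (degγ : γ → σ →₀ ℕ) (e : γ ≃ List ι) (w : ι → S) (W : γ → S)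

/-- **WEIGHTING IS COMPATIBLE WITH THE CHAIN DECOMPOSITION FOR ANY MULTIPLICATIVE CENTRAL WEIGHTS** (the algebraic identity
behind `§3`; the specific choice weight = `1/|Aut|` = labelled frequency is bookkeeping on top of it): if `ampγ g` is the chain
kernel of the letters of `g` and `W g = Π_{i ∈ e g} w i`, then `W g • ampγ g` is the chain kernel of the weighted letters
`w i • amp i`. [cite: Balaban1983Higgs3, (1.21)–(1.22) p.416] -/
theorem hamp_smul_of_prod (hamp : ∀ g, ampγ g = chainAmp C0 amp (e g)) (hW : ∀ g, ((e g).map w).prod = W g) (g : γ) :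
    W g • ampγ g = chainAmp C0 (fun i => w i • amp i) (e g) := by
  rw [chainAmp_smul, hW, hamp]

/-- **BRICK 2's series identity for weighted kernels, any multiplicative central weights.**
[cite: Balaban1983Higgs3, (1.21)–(1.22) p.416] -/
theorem sigmaSeries_smul_eq_greenSeries (hamp : ∀ g, ampγ g = chainAmp C0 amp (e g))
    (hW : ∀ g, ((e g).map w).prod = W g) (hdeg : ∀ g, degγ g = chainDeg deg (e g)) :
    sigmaSeries (fun g => W g • ampγ g) degγ = greenSeries C0 (fun i => w i • amp i) deg :=
  sigmaSeries_eq_greenSeries_of_equiv C0 _ deg _ degγ e (hamp_smul_of_prod C0 amp ampγ e w W hamp hW) hdeg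

/-- **The Dyson equation (1.21) for weighted kernels, any multiplicative central weights.**
[cite: Balaban1983Higgs3, (1.21)–(1.22) p.416] -/
theorem eq121_smul (hamp : ∀ g, ampγ g = chainAmp C0 amp (e g)) (hW : ∀ g, ((e g).map w).prod = W g)
    (hdeg : ∀ g, degγ g = chainDeg deg (e g)) (hne : ∀ i, deg i ≠ 0) (hfin : ∀ d, {i | deg i = d}.Finite) :
    Eq121 (sigmaSeries (fun g => W g • ampγ g) degγ) (MvPowerSeries.C C0) (sigmaSeries (fun i => w i • amp i) deg) :=
  eq121_sigmaSeries_of_equiv C0 _ deg _ degγ e (hamp_smul_of_prod C0 amp ampγ e w W hamp hW) hdeg hne hfin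

/-- **The printed series `Σ_n C₀[XC₀]ⁿ` for weighted kernels, any multiplicative central weights.**
[cite: Balaban1983Higgs3, (1.21) p.416] -/
theorem sigmaSeries_smul_eq_tsum_dysonTerm [TopologicalSpace R] [T2Space R]
    (hamp : ∀ g, ampγ g = chainAmp C0 amp (e g)) (hW : ∀ g, ((e g).map w).prod = W g)
    (hdeg : ∀ g, degγ g = chainDeg deg (e g)) (hne : ∀ i, deg i ≠ 0) (hfin : ∀ d, {i | deg i = d}.Finite) :
    open MvPowerSeries.WithPiTopology in
    sigmaSeries (fun g => W g • ampγ g) degγ =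
      ∑' n, dysonTerm (MvPowerSeries.C C0) (sigmaSeries (fun i => w i • amp i) deg) n :=
  sigmaSeries_eq_tsum_dysonTerm_of_equiv C0 _ deg _ degγ e (hamp_smul_of_prod C0 amp ampγ e w W hamp hW) hdeg hne hfin

end AnyWeights

/-! ## §2 The symmetry weights on the class index of (1.21) -/

section Weights

variable {nbar : ℕ}

/-- **THE SYMMETRY WEIGHT OF A LETTER CLASS** `1/|Aut c|` («(ours)»; FILE D's `autCard` = FILE 2's rigid vertex-relabelling
symmetry number of the class). [cite: Balaban1983Higgs3, (1.21)–(1.22) p.416] -/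
noncomputable def letterWeight (c : LetterClass nbar) : ℚ := (autCard c.1 : ℚ)⁻¹

/-- **THE SYMMETRY WEIGHT OF A TERM OF (1.21)**: `1` for the bare line `C₀^ε` (`none`), `1/|Aut ⟦T⟧|` for the class of an
unglueable two-leg insertion. [cite: Balaban1983Higgs3, (1.21)–(1.22) p.416] -/
noncomputable def termWeight : Option (UnglueableClass nbar) → ℚ
  | none => 1
  | some x => (autCard x.1 : ℚ)⁻¹

/-- kernel: the weight of the bare line. [cite: Balaban1983Higgs3, (1.21) p.416] -/
@[simp] theorem termWeight_none : termWeight (none : Option (UnglueableClass nbar)) = 1 := rfl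

/-- kernel: the weight of the class of an insertion. [cite: Balaban1983Higgs3, (1.21)–(1.22) p.416] -/
@[simp] theorem termWeight_some (x : UnglueableClass nbar) : termWeight (some x) = (autCard x.1 : ℚ)⁻¹ := rfl

/-- kernel: weights are positive. [cite: Balaban1983Higgs3, (1.21)–(1.22) p.416] -/
theorem letterWeight_pos (c : LetterClass nbar) : 0 < letterWeight c :=
  inv_pos.mpr (Nat.cast_pos.mpr (autCard_pos c.1))

/-- kernel: weights are positive. [cite: Balaban1983Higgs3, (1.21)–(1.22) p.416] -/
theorem termWeight_pos (g : Option (UnglueableClass nbar)) : 0 < termWeight g := by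
  cases g with
  | none => exact one_pos
  | some x => exact inv_pos.mpr (Nat.cast_pos.mpr (autCard_pos x.1))

/-- **THE WEIGHT OF A TERM IS THE PRODUCT OF THE WEIGHTS OF ITS LETTERS** — FILE D's `autCard_eq_prod_classEquiv` read through
gen 44's index bijection `classEquivList : Option (UnglueableClass) ≃ List (LetterClass)` of (1.21):
`termWeight g = Π_{c ∈ classEquivList g} letterWeight c`. [cite: Balaban1983Higgs3, (1.21)–(1.22) p.416] -/
theorem prod_letterWeight_classEquivList (g : Option (UnglueableClass nbar)) :
    ((classEquivList g).map letterWeight).prod = termWeight g := by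
  cases g with
  | none => simp
  | some x =>
      rw [classEquivList_some, termWeight_some, ← classEquiv_apply, autCard_eq_prod_classEquiv x, List.map_cons,
        List.prod_cons, Nat.cast_mul, Nat.cast_list_prod, mul_inv, letterWeight, List.prod_inv, List.map_map, List.map_map]
      rfl

/-- **THE WEIGHT OF A CLASS IS ITS LABELLED FREQUENCY**: for an insertion `T` on the `V` labelled vertices,
`termWeight ⟦T⟧ = #{T′ on the V labels ≅ T} / V!` — the symmetry weight `1/|Aut T|` is the fraction of the `V!` relabellings
that produce distinct labelled insertions (FILE 2's orbit–stabilizer `ncard_isoTL_mul_card_aut`, FILE D's `autCard_mkC`).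
[cite: Balaban1983Higgs3, (1.21)–(1.22) p.416] -/
theorem termWeight_some_mkC_eq_ncard_div_factorial {V : ℕ} (T : B3GraphRelabelling.TwoLegOn nbar V)
    (hU : B3OnePIChainPieceGraphs.Unglueable T.1) :
    termWeight (some ⟨mkC T.1, unglueableC_mkC.2 hU⟩) =
      ({T' : B3GraphRelabelling.TwoLegOn nbar V | Nonempty (B3GraphIso.TwoLegGraphIso T'.1 T.1)}.ncard : ℚ) /
        (V.factorial : ℚ) := by
  have h := B3GraphRelabelling.ncard_isoTL_mul_card_aut T
  have hV : (V.factorial : ℚ) ≠ 0 := Nat.cast_ne_zero.mpr (Nat.factorial_ne_zero V)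
  have ha : (Nat.card (B3GraphIso.TwoLegGraphIso T.1 T.1) : ℚ) ≠ 0 :=
    Nat.cast_ne_zero.mpr (B3GraphRelabelling.card_twoLegGraphIso_self_pos T.1).ne'
  rw [termWeight_some]
  change ((autCard (mkC T.1) : ℕ) : ℚ)⁻¹ = _
  rw [autCard_mkC, eq_div_iff hV, inv_mul_eq_iff_eq_mul₀ ha, ← Nat.cast_mul, ← h, mul_comm]

end Weights

/-! ## §3 (1.21) with the symmetry weights written -/

section Weighted

variable {nbar : ℕ} {R : Type*} [Ring R] [Algebra ℚ R] {σ : Type*} (C0 : R)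
  (a : LetterClass nbar → R) (A : Option (UnglueableClass nbar) → R)
  (deg : LetterClass nbar → σ →₀ ℕ) (degγ : Option (UnglueableClass nbar) → σ →₀ ℕ)

/-- **THE WEIGHTED KERNELS ARE CONSISTENT ALONG (1.21) WHENEVER THE UNWEIGHTED ONES ARE**: if the kernel of every connected
two-point class is the chain kernel `C₀K₁C₀⋯K_mC₀` of the kernels of its letter classes (the values side — p37's
`B3ChainRegroupingValues` / `B3OnePIChainAmplitude`, taken as the hypothesis `hA`), then the SYMMETRY-WEIGHTED kernels
`(1/|Aut g|)·A g` and `(1/|Aut c|)·a c` satisfy the same relation — because the weight of a chain is the product of the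
weights of its letters (FILE D). [cite: Balaban1983Higgs3, (1.21)–(1.22) p.416] -/
theorem weighted_hamp (hA : ∀ g, A g = chainAmp C0 a (classEquivList g)) (g : Option (UnglueableClass nbar)) :
    termWeight g • A g = chainAmp C0 (fun c => letterWeight c • a c) (classEquivList g) :=
  hamp_smul_of_prod C0 a A classEquivList letterWeight termWeight hA prod_letterWeight_classEquivList g

/-- **(1.21) WITH THE COMBINATORIC FACTORS `1/|Aut|` WRITTEN, as generating series**: under the unweighted consistency
`hA` and the additivity of the orders along chains `hdeg` (BRICK 2's hypotheses on the index bijection `classEquivList`), the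
series of the symmetry-weighted connected two-point classes IS the chain series of the symmetry-weighted letter classes
(BRICK 2's `sigmaSeries_eq_greenSeries_of_equiv`). [cite: Balaban1983Higgs3, (1.21)–(1.22) p.416] -/
theorem sigmaSeries_weighted_eq_greenSeries (hA : ∀ g, A g = chainAmp C0 a (classEquivList g))
    (hdeg : ∀ g, degγ g = chainDeg deg (classEquivList g)) :
    sigmaSeries (fun g => termWeight g • A g) degγ = greenSeries C0 (fun c => letterWeight c • a c) deg :=
  sigmaSeries_eq_greenSeries_of_equiv C0 _ deg _ degγ classEquivList (weighted_hamp C0 a A hA) hdeg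

/-- **THE DYSON EQUATION (1.21) FOR THE SYMMETRY-WEIGHTED CLASS SERIES**: `G = C₀ + C₀XG` (BRICK 2's `Eq121`) with
`G = Σ_g (1/|Aut g|)·A g·e^{deg g}` over the bare line and the classes of unglueable insertions and
`X = Σ_c (1/|Aut c|)·a c·e^{deg c}` over the letter classes — given `hA`, `hdeg`, positive letter orders and local finiteness
(BRICK 2's `eq121_sigmaSeries_of_equiv`).
[cite: Balaban1983Higgs3, (1.21)–(1.22) p.416] -/
theorem eq121_weighted (hA : ∀ g, A g = chainAmp C0 a (classEquivList g))
    (hdeg : ∀ g, degγ g = chainDeg deg (classEquivList g)) (hne : ∀ c, deg c ≠ 0)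
    (hfin : ∀ d, {c | deg c = d}.Finite) :
    Eq121 (sigmaSeries (fun g => termWeight g • A g) degγ) (MvPowerSeries.C C0)
      (sigmaSeries (fun c => letterWeight c • a c) deg) :=
  eq121_sigmaSeries_of_equiv C0 _ deg _ degγ classEquivList (weighted_hamp C0 a A hA) hdeg hne hfin

/-- **… AND AS THE PRINTED SERIES `Σ_n C₀[XC₀]ⁿ`** (BRICK 2's `sigmaSeries_eq_tsum_dysonTerm_of_equiv`).
[cite: Balaban1983Higgs3, (1.21) p.416] -/
theorem sigmaSeries_weighted_eq_tsum_dysonTerm [TopologicalSpace R] [T2Space R]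
    (hA : ∀ g, A g = chainAmp C0 a (classEquivList g))
    (hdeg : ∀ g, degγ g = chainDeg deg (classEquivList g)) (hne : ∀ c, deg c ≠ 0)
    (hfin : ∀ d, {c | deg c = d}.Finite) :
    open MvPowerSeries.WithPiTopology in
    sigmaSeries (fun g => termWeight g • A g) degγ =
      ∑' n, dysonTerm (MvPowerSeries.C C0) (sigmaSeries (fun c => letterWeight c • a c) deg) n :=
  sigmaSeries_eq_tsum_dysonTerm_of_equiv C0 _ deg _ degγ classEquivList (weighted_hamp C0 a A hA) hdeg hne hfin

end Weighted

end Literature.MathematicalPhysics.QuantumFieldTheory.Balaban1983to89.B3Eq121SymmetryWeights
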